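import Literature.MathematicalPhysics.QuantumFieldTheory.Balaban1983to89.B2Eq237FormSplit
import Literature.MathematicalPhysics.QuantumFieldTheory.Balaban1983to89.B2Eq238ScalarBoundary

/-!
# `Balaban1983to89.B2Eq225PsiOne` — [Balaban1982Higgs2] (2.25) p. 562: the translated scalar field at the points of `Λ₇`
equals `ψ^{(1)} = aL⁻²G₁(Λ₂, B^{(1)})Q*(B^{(1)})Λ′₆ψ` up to `O(ε^κ)` — the exact decomposition PROVED and the `O(ε^κ)` PROVED
(pointwise in `x ∈ Λ₇`) from the Prop. I.2.1 / I.2.3 shapes + the separations of (2.8), *"for arbitrary κ"* (`κ > d`)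

statement-level skeleton of published theorems with citation tags; proofs where landed; nothing here is a claim about the Yang–Mills mass gap

PDF held: `paper:balaban1982-cmp86-higgs23-ii` (T. Bałaban, *(Higgs)₂,₃ quantum fields in a finite volume. II. An upper
bound*, Commun. Math. Phys. **86** (1982) 555–594, doi 10.1007/bf01214890; journal page = PDF page + 554); p. 562 [PDF 8]
READ AS AN IMAGE (`run/shared/lean/pub/pub-balaban/b2b-balaban-ref1/pages/1982-cmp86-higgs23-II/…-p008-x2.png`); part I
[Balaban1982Higgs1] Prop. 2.1 p. 610, Prop. 2.3 p. 611 [PDF 8–9] likewise.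

CITATION HEADER — WHAT IS REPRODUCED.  SKELETON row **B2.Eq2.42** ((2.20)–(2.42)), member **(2.25)** p. 562 (one of the
row's «absent residue» estimates per the B2 fold ROWS-B2 v2.16).  Unit `lit-balaban-p15` gen 3 (Phase-2 proof seat p15; HOME
`run/shared/lean/pub/lit-balaban/`, seat dir `lit-balaban-p15/`); B2 fold owner r02, second reader r14; referee ref-4.  Inputs
by name: r02's `B2Eq224FirstStepFields.transl223` ((2.23)), **`psiOne`** (the defined `ψ^{(1)}` of (2.25), whose docstring
says *"the O(ε^κ) replacement asserted by (2.25) … is an estimate and is NOT stated here"* — it is PROVED here, modulo the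
printed shapes), `covΛ_mulVec_eq_zero`, `B2Eq218Translation.restrict`; p23 g4's pointwise engines
`B2Lemma25Proof.far_sum_bound` / `damped_sum_bound` (p247392); this seat's `B2Eq236Replacements.abs_Qs_restrict_le`,
`pFn_le_rpow` and `B2Eq238ScalarBoundary.abs_Qs_mulVec_le_of_mem`; r14's `B2StepK.rDecayBeatsPowers`.

WHAT IS PRINTED (p. 562 [PDF 8], verbatim).  *"B^{(1)} = aL⁻²ζC^{(0)}Q*B, (2.24) and let us notice that Lemma 2.3 implies also
(∂_μB^{(1)})(x) = O(p(ε)) for x ∈ Λ₂, μ = 1, …, d. Hence the assumptions of Proposition I.2 are satisfied for B^{(1)} on Λ₂, and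
we have aL⁻²(C^{(0)}_{Λ₃}(B̃^{(1)})Q*(B̃^{(1)})ψ)(x) = aL⁻²(G₁(Λ₂, B^{(1)})Q*(B^{(1)})Λ′₆ψ)(x) + O(ε^κ) =: ψ^{(1)}(x) + O(ε^κ),
κ > d, x ∈ Λ₇. (2.25)"*; (2.35) p. 565: *"B̃^{(1)} = B^{(1)} on Λ₂"*; the inputs Prop. I.2.1 (2.25)–(2.26) p. 610 (decay of
`G_k(Ω, A)f` and the extra factor `exp(−δ₀dist(supp f, Ωᶜ) − δ₀dist(x, Ωᶜ))` for `G(Ω, A) − G(Ω₀, A)`), Prop. I.2.3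
(2.34)/(2.36) p. 611 (decay of `C^{(k)}_Λ`; `C^{(k)}_Λ − C^{(k)}` doubly damped in the distance to `Λᶜ`), the geometry (2.8)
p. 558 (`Λ₇` is `4r(ε)` inside `Λ₃` and `r(ε)` inside `Λ₆`) and the smallness of `ψ` on the small-field blocks (2.16)–(2.17).

THE ARGUMENT (the print gives the pointer only).  At `x ∈ Λ₇`: (a) `B̃^{(1)} = B^{(1)}` on `Λ₂ ⊇ Λ₃`, and `C^{(0)}_{Λ₃}` sees
`Q*ψ` only on `Λ₃`, so `Q*(B̃^{(1)})` may be replaced by `Q*(B^{(1)})` EXACTLY (`covΛ_mulVec_congr`); (b) `ψ = Λ′₆ᶜψ + Λ′₆ψ`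
and the `Λ′₆ᶜψ` part is FAR from `x` (blocks outside `Λ′₆` are `≥ r(ε)` from `Λ₇`): `O(e^{−½δ₀r(ε)})·(threshold)` by (I.2.34);
(c) on `Λ′₆ψ` the kernel `C^{(0)}_{Λ₃}(B)` is replaced by `G₁(Λ₂, B)` at the ROW-DAMPED cost `O(e^{−δ₀dist(x, Λ₃ᶜ)})·
(threshold)`, `dist(x, Λ₃ᶜ) ≥ 4r(ε)` ((I.2.36) for `C_{Λ₃} − C`, (I.2.26) for `C − G₁(Λ₂)` since `dist(·, Λ₂ᶜ) ≥
dist(·, Λ₃ᶜ)`).  Both are `O(ε^κ)` for every κ (`rDecayBeatsPowers`).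

DICTIONARY (r02's plain real coordinates): `X`/`Y` fine/block components; `c` ↤ `aL⁻²`; `CΛ` ↤ `C^{(0)}_{Λ₃}(B̃^{(1)}) =
C^{(0)}_{Λ₃}(B^{(1)})` (zero-extended, `hCs`; decay `hK` (I.2.34)); `G1` ↤ `G₁(Λ₂, B^{(1)})`; `Qst`, `Qs` ↤ `Q*(B̃^{(1)})`,
`Q*(B^{(1)})` (equal on the rows in `Λ₃`: `hQt`); `Λ` ↤ `Λ₃` (fine), `Λ'` ↤ `Λ′₃` (blocks; `hQ` block structure transported
to `Qs` via `hQs`), `Λ₆'` ↤ `Λ′₆`; the point `x` ↤ `x ∈ Λ₇` with its printed geometry as hypotheses: `hsep` (blocks outside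
`Λ′₆` are `≥ R` away from `x`), `hux : R ≤ ux` (`ux` ↤ `dist(x, Λ₃ᶜ)`); the ROW-DAMPED shape `hδG` for `CΛ − G1` at the row
`x`; `Gψ` ↤ the threshold for `|ψ|` on `Λ′₃`; `qs₁` ↤ `sup_{x″}Σ_y|Q*(x″,y)|`; `Ssum` ↤ `Σ_{x″}e^{−½δ₀|x−x″|}`.

WHAT IS KERNEL-CHECKED (zero `sorry`, standard axioms, no definitions).
 §0 `decay_threshold_pow₁` (*"arbitrary κ"* for ONE threshold `K·p(ℓ)·ℓ^{−m}`: (2.25) is linear in `ψ`);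
 §1 `covΛ_mulVec_congr` / `covΛ_Qs_congr` (step (a), exact), **`eq225_exact`** (`aL⁻²(C_{Λ₃}Q*ψ)(x) = ψ^{(1)}(x) + [far](x) + [δG](x)` with
    r02's `psiOne` BY NAME);
 §2 **`eq225_far_bound`** (`|[far](x)| ≤ |c|·c₀e^{−½δ₀R}·qs₁Gψ·Ssum`), **`eq225_damped_bound`** (`|[δG](x)| ≤
    |c|·c₀e^{−δ₀R}·qs₁Gψ·Ssum`), **`eq225_error_bound`**, **`eq225_error_pow`** (`≤ 2|c|c₀qs₁Ssum·C_κℓ^κ`: the printed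
    `O(ε^κ)`, pointwise in `x ∈ Λ₇`).
HONEST SCOPE.  Kernels are data; (I.2.34), the row-damped shape, the Dirichlet support, the block structure and the
separations of (2.8) are HYPOTHESES in the printed form; `B̃^{(1)} = B^{(1)}` on `Λ₂` enters as the row equality `hQt`; the
smallness of `∂B^{(1)}` (Lemma 2.3 ⇒ Prop. I.2 applies) is what makes the shapes available and is not re-derived.
-/

namespace Literature.MathematicalPhysics.QuantumFieldTheory.Balaban1983to89.B2Eq225PsiOne

open Real Matrix
open B2Eq218Translation (restrict)
open B2Eq224FirstStepFields (psiOne)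
open B2Lemma25Proof (far_sum_bound damped_sum_bound)
open B2Eq236Replacements (pFn_le_rpow pFn_nonneg abs_Qs_restrict_le exists_of_Qs_restrict_ne_zero)
open B2Eq237FormSplit (rFn_nonneg)
open B2Eq238ScalarBoundary (abs_Qs_mulVec_le_of_mem)

/-! ## §0 *"for arbitrary κ"* with one threshold -/

/-- **"κ > d" / "arbitrary κ"** for an expression LINEAR in one threshold `T = K·p(ℓ)·ℓ^{−m}`: for `a > 0`, `R > 0`, `r > 1`,
`b₀ ≥ 0`, `p ≥ 0`, `K ≥ 0` and every real `κ` there is `C ≥ 0` with `e^{−a·r(ℓ)}·T(ℓ) ≤ C·ℓ^κ` on `(0,1]`.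
[cite: Balaban1982Higgs2, (2.25) p.562] -/
theorem decay_threshold_pow₁ {a Rr r b₀ p K m : ℝ} (ha : 0 < a) (hR : 0 < Rr) (hr : 1 < r) (hb : 0 ≤ b₀) (hp : 0 ≤ p)
    (hK : 0 ≤ K) (κ : ℝ) :
    ∃ C : ℝ, 0 ≤ C ∧ ∀ ℓ : ℝ, 0 < ℓ → ℓ ≤ 1 →
      Real.exp (-(a * B2.rFn Rr r ℓ)) * (K * B2.pFn b₀ p ℓ * ℓ ^ (-m)) ≤ C * ℓ ^ κ := by
  obtain ⟨C₀, hC₀⟩ := B2StepK.rDecayBeatsPowers ha hR hr (κ + p + m)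
  refine ⟨max C₀ 0 * (K * b₀), by positivity, fun ℓ hℓ hℓ1 => ?_⟩
  have hexp : Real.exp (-(a * B2.rFn Rr r ℓ)) ≤ max C₀ 0 * ℓ ^ (κ + p + m) :=
    (hC₀ ℓ hℓ hℓ1).trans (mul_le_mul_of_nonneg_right (le_max_left _ _) (Real.rpow_nonneg hℓ.le _))
  have hT : K * B2.pFn b₀ p ℓ * ℓ ^ (-m) ≤ K * (b₀ * ℓ ^ (-p)) * ℓ ^ (-m) :=
    mul_le_mul_of_nonneg_right (mul_le_mul_of_nonneg_left (pFn_le_rpow hb hp hℓ hℓ1) hK) (Real.rpow_nonneg hℓ.le _)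
  have hT0 : 0 ≤ K * B2.pFn b₀ p ℓ * ℓ ^ (-m) :=
    mul_nonneg (mul_nonneg hK (pFn_nonneg hb hℓ hℓ1)) (Real.rpow_nonneg hℓ.le _)
  calc Real.exp (-(a * B2.rFn Rr r ℓ)) * (K * B2.pFn b₀ p ℓ * ℓ ^ (-m))
      ≤ (max C₀ 0 * ℓ ^ (κ + p + m)) * (K * (b₀ * ℓ ^ (-p)) * ℓ ^ (-m)) :=
        mul_le_mul hexp hT hT0 (by positivity)
    _ = max C₀ 0 * (K * b₀) * (ℓ ^ (κ + p + m) * ℓ ^ (-p) * ℓ ^ (-m)) := by ring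
    _ = max C₀ 0 * (K * b₀) * ℓ ^ κ := by
        rw [← Real.rpow_add hℓ, ← Real.rpow_add hℓ]
        ring_nf

/-! ## §1 **(2.25)**, the exact decomposition -/

section Exact

variable {X Y : Type*} [Fintype X] [Fintype Y] [DecidableEq Y]

omit [Fintype Y] [DecidableEq Y] in
/-- Step (a): `C^{(0)}_{Λ₃}` sees a function only on `Λ₃` (Dirichlet support), so `Q*(B̃^{(1)})ψ` may be replaced by
`Q*(B^{(1)})ψ` as soon as they agree on `Λ₃` (`B̃^{(1)} = B^{(1)}` on `Λ₂ ⊇ Λ₃`, (2.35)). [cite: Balaban1982Higgs2, (2.35) p.565] -/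
theorem covΛ_mulVec_congr {Λ : Finset X} {CΛ : Matrix X X ℝ} (hCs : ∀ x x', CΛ x x' ≠ 0 → x ∈ Λ ∧ x' ∈ Λ)
    {u v : X → ℝ} (huv : ∀ x'' ∈ Λ, u x'' = v x'') : CΛ *ᵥ u = CΛ *ᵥ v := by
  funext x
  change ∑ x'', CΛ x x'' * u x'' = ∑ x'', CΛ x x'' * v x''
  refine Finset.sum_congr rfl fun x'' _ => ?_
  by_cases h : CΛ x x'' = 0
  · rw [h, zero_mul, zero_mul]
  · rw [huv x'' (hCs x x'' h).2]

omit [DecidableEq Y] in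
/-- Step (a) for the averaging: if `Q*(B̃^{(1)})` and `Q*(B^{(1)})` agree on the rows in `Λ₃`, then
`C^{(0)}_{Λ₃}Q*(B̃^{(1)})ψ = C^{(0)}_{Λ₃}Q*(B^{(1)})ψ`. [cite: Balaban1982Higgs2, (2.25) p.562] -/
theorem covΛ_Qs_congr {Λ : Finset X} {CΛ : Matrix X X ℝ} {Qst Qs : Matrix X Y ℝ}
    (hCs : ∀ x x', CΛ x x' ≠ 0 → x ∈ Λ ∧ x' ∈ Λ) (hQt : ∀ x'' ∈ Λ, ∀ y, Qst x'' y = Qs x'' y) (ψ : Y → ℝ) :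
    CΛ *ᵥ (Qst *ᵥ ψ) = CΛ *ᵥ (Qs *ᵥ ψ) := by
  refine covΛ_mulVec_congr hCs fun x'' hx'' => ?_
  change ∑ y, Qst x'' y * ψ y = ∑ y, Qs x'' y * ψ y
  exact Finset.sum_congr rfl fun y _ => by rw [hQt x'' hx'' y]

/-- **(2.25), EXACT form**: `aL⁻²(C^{(0)}_{Λ₃}Q*ψ)(x) = ψ^{(1)}(x) + aL⁻²(C^{(0)}_{Λ₃}Q*Λ′₆ᶜψ)(x) + aL⁻²((C^{(0)}_{Λ₃} − G₁)Q*Λ′₆ψ)(x)`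
with r02's `psiOne c G1 Qs Λ₆' ψ = aL⁻²G₁Q*Λ′₆ψ` — the last two summands are the printed `O(ε^κ)` (`eq225_error_bound`).
[cite: Balaban1982Higgs2, (2.25) p.562] -/
theorem eq225_exact (c : ℝ) (CΛ G1 : Matrix X X ℝ) (Qs : Matrix X Y ℝ) (Λ₆' : Finset Y) (ψ : Y → ℝ) (x : X) :
    c * (CΛ *ᵥ (Qs *ᵥ ψ)) x
      = psiOne c G1 Qs Λ₆' ψ x
        + (c * (CΛ *ᵥ (Qs *ᵥ (ψ - restrict Λ₆' ψ))) x + c * ((CΛ - G1) *ᵥ (Qs *ᵥ restrict Λ₆' ψ)) x) := by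
  rw [B2Eq224FirstStepFields.psiOne_apply]
  have hψ : ψ = (ψ - restrict Λ₆' ψ) + restrict Λ₆' ψ := (sub_add_cancel _ _).symm
  conv_lhs => rw [hψ]
  rw [Matrix.mulVec_add, Matrix.mulVec_add, Matrix.sub_mulVec]
  simp only [Pi.add_apply, Pi.sub_apply]
  ring

end Exact

/-! ## §2 **(2.25)**, the `O(ε^κ)` at a point `x ∈ Λ₇` -/

section Error

variable {X Y : Type*} [Fintype X] [Fintype Y] [DecidableEq Y]

/-- **(2.25), the far part**: at `x` with all blocks outside `Λ′₆` at distance `≥ R` ((2.8): `x ∈ Λ₇`), (I.2.34) for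
`C^{(0)}_{Λ₃}` and `|ψ| ≤ Gψ` on `Λ′₃`: `|aL⁻²(C^{(0)}_{Λ₃}Q*Λ′₆ᶜψ)(x)| ≤ |c|·c₀e^{−½δ₀R}·qs₁Gψ·Ssum`.
[cite: Balaban1982Higgs2, (2.25) p.562] -/
theorem eq225_far_bound {c w : ℝ} {Λ : Finset X} {Λ' Λ₆' : Finset Y} {Q : Matrix Y X ℝ} {Qs : Matrix X Y ℝ}
    {CΛ : Matrix X X ℝ} {ψ : Y → ℝ} {d : X → X → ℝ} {x : X} {c₀ δ R Gψ qs₁ Ssum : ℝ}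
    (hc₀ : 0 ≤ c₀) (hδ : 0 ≤ δ) (hGψ : 0 ≤ Gψ) (hqs : 0 ≤ qs₁)
    (hQs : Qs = w • Qᵀ) (hQ : ∀ y x, Q y x ≠ 0 → (x ∈ Λ ↔ y ∈ Λ')) (hCs : ∀ x x', CΛ x x' ≠ 0 → x ∈ Λ ∧ x' ∈ Λ)
    (hK : ∀ x'', |CΛ x x''| ≤ c₀ * Real.exp (-(δ * d x x'')))
    (hsep : ∀ x'' y, y ∉ Λ₆' → Qs x'' y ≠ 0 → R ≤ d x x'')
    (hψ : ∀ y ∈ Λ', |ψ y| ≤ Gψ) (hQs1 : ∀ x'', ∑ y, |Qs x'' y| ≤ qs₁)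
    (hS : ∑ x'', Real.exp (-(δ / 2 * d x x'')) ≤ Ssum) :
    |c * (CΛ *ᵥ (Qs *ᵥ (ψ - restrict Λ₆' ψ))) x| ≤ |c| * (c₀ * Real.exp (-(δ / 2 * R)) * (qs₁ * Gψ) * Ssum) := by
  rw [abs_mul]
  refine mul_le_mul_of_nonneg_left ?_ (abs_nonneg c)
  have hψo : ∀ y ∈ Λ', |(ψ - restrict Λ₆' ψ) y| ≤ Gψ := by
    intro y hy
    rw [Pi.sub_apply]
    unfold restrict
    split_ifs
    · rw [sub_self, abs_zero]
      exact hGψ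
    · rw [sub_zero]
      exact hψ y hy
  -- restrict the sum to Λ (Dirichlet support)
  have hre : (CΛ *ᵥ (Qs *ᵥ (ψ - restrict Λ₆' ψ))) x
      = ∑ x'' ∈ Λ, CΛ x x'' * (Qs *ᵥ (ψ - restrict Λ₆' ψ)) x'' := by
    change ∑ x'', CΛ x x'' * (Qs *ᵥ (ψ - restrict Λ₆' ψ)) x'' = _
    symm
    apply Finset.sum_subset (Finset.subset_univ Λ)
    intro x'' _ hx''
    have h0 : CΛ x x'' = 0 := by
      by_contra h
      exact hx'' (hCs x x'' h).2
    rw [h0, zero_mul]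
  rw [hre]
  refine far_sum_bound (S := Λ) (K := fun x'' => CΛ x x'') (g := Qs *ᵥ (ψ - restrict Λ₆' ψ))
    (d := fun x'' => d x x'') hc₀ hδ (mul_nonneg hqs hGψ) (fun x'' _ => hK x'') ?_
    (fun x'' hx'' => abs_Qs_mulVec_le_of_mem hQs hQ hGψ hψo hQs1 hx'') ?_
  · intro x'' _ hg
    have hg' : (∑ y, Qs x'' y * (ψ - restrict Λ₆' ψ) y) ≠ 0 := hg
    obtain ⟨y, -, hy⟩ := Finset.exists_ne_zero_of_sum_ne_zero hg'
    have hyQ : Qs x'' y ≠ 0 := fun h0 => hy (by rw [h0, zero_mul])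
    have hy6 : y ∉ Λ₆' := by
      intro hy6
      apply hy
      rw [Pi.sub_apply, show restrict Λ₆' ψ y = ψ y from if_pos hy6, sub_self, mul_zero]
    exact hsep x'' y hy6 hyQ
  · exact (Finset.sum_le_sum_of_subset_of_nonneg (Finset.subset_univ Λ) fun _ _ _ => (Real.exp_pos _).le).trans hS

omit [Fintype X] in
/-- **(2.25), the kernel part**: at `x` with `dist(x, Λ₃ᶜ) =: ux ≥ R` ((2.8): `x ∈ Λ₇`), the ROW-DAMPED shape
`|C^{(0)}_{Λ₃}(x,x″) − G₁(x,x″)| ≤ c₀e^{−δ(|x−x″| + ux)}` (Prop. I.2.3 (2.36) + Prop. I.2.1 (2.26)) and `|ψ| ≤ Gψ` on `Λ′₆`: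
`|aL⁻²((C^{(0)}_{Λ₃} − G₁)Q*Λ′₆ψ)(x)| ≤ |c|·c₀e^{−δ₀R}·qs₁Gψ·Ssum`. [cite: Balaban1982Higgs2, (2.25) p.562] -/
theorem eq225_damped_bound [Fintype X] {c : ℝ} {Λ₆' : Finset Y} {Qs : Matrix X Y ℝ} {CΛ G1 : Matrix X X ℝ}
    {ψ : Y → ℝ} {d : X → X → ℝ} {x : X} {c₀ δ R ux Gψ qs₁ Ssum : ℝ}
    (hc₀ : 0 ≤ c₀) (hδ : 0 ≤ δ) (hGψ : 0 ≤ Gψ) (hqs : 0 ≤ qs₁) (hux : R ≤ ux) (hd : ∀ x'', 0 ≤ d x x'')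
    (hδG : ∀ x'', |CΛ x x'' - G1 x x''| ≤ c₀ * Real.exp (-(δ * (d x x'' + ux))))
    (hψ : ∀ y ∈ Λ₆', |ψ y| ≤ Gψ) (hQs1 : ∀ x'', ∑ y, |Qs x'' y| ≤ qs₁)
    (hS : ∑ x'', Real.exp (-(δ / 2 * d x x'')) ≤ Ssum) :
    |c * ((CΛ - G1) *ᵥ (Qs *ᵥ restrict Λ₆' ψ)) x| ≤ |c| * (c₀ * Real.exp (-(δ * R)) * (qs₁ * Gψ) * Ssum) := by
  rw [abs_mul]
  refine mul_le_mul_of_nonneg_left ?_ (abs_nonneg c)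
  change |∑ x'', (CΛ - G1) x x'' * (Qs *ᵥ restrict Λ₆' ψ) x''| ≤ _
  have hD' : ∀ x'' ∈ (Finset.univ : Finset X), |(CΛ - G1) x x''|
      ≤ c₀ * Real.exp (-(δ * (d x x'' + ux + (fun _ => (0 : ℝ)) x''))) := by
    intro x'' _
    rw [Matrix.sub_apply]
    simpa only [add_zero] using hδG x''
  exact damped_sum_bound (S := Finset.univ) (D := fun x'' => (CΛ - G1) x x'') (g := Qs *ᵥ restrict Λ₆' ψ)
    (d := fun x'' => d x x'') (u' := fun _ => (0 : ℝ)) hc₀ hδ (mul_nonneg hqs hGψ) hux (fun _ _ => le_rfl)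
    (fun x'' _ => hd x'') hD' (fun x'' _ => abs_Qs_restrict_le hGψ hψ hQs1 x'') hS

/-- **(2.25), the error bound**: `|aL⁻²(C^{(0)}_{Λ₃}Q*ψ)(x) − ψ^{(1)}(x)| ≤ |c|·c₀·qs₁Gψ·Ssum·(e^{−½δ₀R} + e^{−δ₀R})` at every
`x` with the printed geometry of `Λ₇` (`hsep`, `hux`). [cite: Balaban1982Higgs2, (2.25) p.562] -/
theorem eq225_error_bound {c w : ℝ} {Λ : Finset X} {Λ' Λ₆' : Finset Y} {Q : Matrix Y X ℝ} {Qs : Matrix X Y ℝ}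
    {CΛ G1 : Matrix X X ℝ} {ψ : Y → ℝ} {d : X → X → ℝ} {x : X} {c₀ δ R ux Gψ qs₁ Ssum : ℝ}
    (hc₀ : 0 ≤ c₀) (hδ : 0 ≤ δ) (hGψ : 0 ≤ Gψ) (hqs : 0 ≤ qs₁) (h6 : Λ₆' ⊆ Λ')
    (hQs : Qs = w • Qᵀ) (hQ : ∀ y x, Q y x ≠ 0 → (x ∈ Λ ↔ y ∈ Λ')) (hCs : ∀ x x', CΛ x x' ≠ 0 → x ∈ Λ ∧ x' ∈ Λ)
    (hK : ∀ x'', |CΛ x x''| ≤ c₀ * Real.exp (-(δ * d x x'')))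
    (hux : R ≤ ux) (hd : ∀ x'', 0 ≤ d x x'')
    (hδG : ∀ x'', |CΛ x x'' - G1 x x''| ≤ c₀ * Real.exp (-(δ * (d x x'' + ux))))
    (hsep : ∀ x'' y, y ∉ Λ₆' → Qs x'' y ≠ 0 → R ≤ d x x'')
    (hψ : ∀ y ∈ Λ', |ψ y| ≤ Gψ) (hQs1 : ∀ x'', ∑ y, |Qs x'' y| ≤ qs₁)
    (hS : ∑ x'', Real.exp (-(δ / 2 * d x x'')) ≤ Ssum) :
    |c * (CΛ *ᵥ (Qs *ᵥ ψ)) x - psiOne c G1 Qs Λ₆' ψ x|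
      ≤ |c| * (c₀ * Real.exp (-(δ / 2 * R)) * (qs₁ * Gψ) * Ssum)
        + |c| * (c₀ * Real.exp (-(δ * R)) * (qs₁ * Gψ) * Ssum) := by
  rw [eq225_exact c CΛ G1 Qs Λ₆' ψ x, add_sub_cancel_left]
  exact (abs_add_le _ _).trans (add_le_add
    (eq225_far_bound hc₀ hδ hGψ hqs hQs hQ hCs hK hsep hψ hQs1 hS)
    (eq225_damped_bound hc₀ hδ hGψ hqs hux hd hδG (fun y hy => hψ y (h6 hy)) hQs1 hS))

/-- **(2.25), "κ > d" (indeed every κ)**: with `R ≥ r(ℓ)` ((2.8)) and `e^{−½δ₀r(ℓ)}·Gψ ≤ C_κℓ^κ` (`decay_threshold_pow₁` at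
the printed threshold for `|ψ|`): `|aL⁻²(C^{(0)}_{Λ₃}Q*ψ)(x) − ψ^{(1)}(x)| ≤ 2|c|c₀qs₁·Ssum·C_κℓ^κ` — the printed `O(ε^κ)` of
(2.25), pointwise on `Λ₇`. [cite: Balaban1982Higgs2, (2.25) p.562] -/
theorem eq225_error_pow {c w : ℝ} {Λ : Finset X} {Λ' Λ₆' : Finset Y} {Q : Matrix Y X ℝ} {Qs : Matrix X Y ℝ}
    {CΛ G1 : Matrix X X ℝ} {ψ : Y → ℝ} {d : X → X → ℝ} {x : X} {c₀ δ R ux Gψ qs₁ Ssum Rr r ℓ κ Cκ : ℝ}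
    (hc₀ : 0 ≤ c₀) (hδ : 0 ≤ δ) (hGψ : 0 ≤ Gψ) (hqs : 0 ≤ qs₁) (hS0 : 0 ≤ Ssum) (h6 : Λ₆' ⊆ Λ')
    (hRr0 : 0 ≤ Rr) (hℓ : 0 < ℓ) (hℓ1 : ℓ ≤ 1) (hRr : B2.rFn Rr r ℓ ≤ R)
    (hCκ : Real.exp (-(δ / 2 * B2.rFn Rr r ℓ)) * Gψ ≤ Cκ * ℓ ^ κ)
    (hQs : Qs = w • Qᵀ) (hQ : ∀ y x, Q y x ≠ 0 → (x ∈ Λ ↔ y ∈ Λ')) (hCs : ∀ x x', CΛ x x' ≠ 0 → x ∈ Λ ∧ x' ∈ Λ)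
    (hK : ∀ x'', |CΛ x x''| ≤ c₀ * Real.exp (-(δ * d x x'')))
    (hux : R ≤ ux) (hd : ∀ x'', 0 ≤ d x x'')
    (hδG : ∀ x'', |CΛ x x'' - G1 x x''| ≤ c₀ * Real.exp (-(δ * (d x x'' + ux))))
    (hsep : ∀ x'' y, y ∉ Λ₆' → Qs x'' y ≠ 0 → R ≤ d x x'')
    (hψ : ∀ y ∈ Λ', |ψ y| ≤ Gψ) (hQs1 : ∀ x'', ∑ y, |Qs x'' y| ≤ qs₁)
    (hS : ∑ x'', Real.exp (-(δ / 2 * d x x'')) ≤ Ssum) :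
    |c * (CΛ *ᵥ (Qs *ᵥ ψ)) x - psiOne c G1 Qs Λ₆' ψ x| ≤ 2 * |c| * c₀ * qs₁ * Ssum * (Cκ * ℓ ^ κ) := by
  have h1 := eq225_error_bound hc₀ hδ hGψ hqs h6 hQs hQ hCs hK hux hd hδG hsep hψ hQs1 hS (c := c)
  have hR0 : 0 ≤ R := (rFn_nonneg hRr0 hℓ hℓ1).trans hRr
  have hexp : Real.exp (-(δ / 2 * R)) ≤ Real.exp (-(δ / 2 * B2.rFn Rr r ℓ)) := by
    rw [Real.exp_le_exp]
    have := mul_le_mul_of_nonneg_left hRr (by positivity : (0 : ℝ) ≤ δ / 2)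
    linarith
  have hexp2 : Real.exp (-(δ * R)) ≤ Real.exp (-(δ / 2 * R)) := by
    rw [Real.exp_le_exp]
    have := mul_nonneg hδ hR0
    linarith
  have h2 : Real.exp (-(δ / 2 * R)) * Gψ ≤ Cκ * ℓ ^ κ := (mul_le_mul_of_nonneg_right hexp hGψ).trans hCκ
  have h3 : Real.exp (-(δ * R)) * Gψ ≤ Cκ * ℓ ^ κ := (mul_le_mul_of_nonneg_right hexp2 hGψ).trans h2
  have hA : 0 ≤ |c| * c₀ * qs₁ * Ssum := by positivity
  refine h1.trans ?_
  calc |c| * (c₀ * Real.exp (-(δ / 2 * R)) * (qs₁ * Gψ) * Ssum) + |c| * (c₀ * Real.exp (-(δ * R)) * (qs₁ * Gψ) * Ssum)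
      = |c| * c₀ * qs₁ * Ssum * (Real.exp (-(δ / 2 * R)) * Gψ)
        + |c| * c₀ * qs₁ * Ssum * (Real.exp (-(δ * R)) * Gψ) := by ring
    _ ≤ |c| * c₀ * qs₁ * Ssum * (Cκ * ℓ ^ κ) + |c| * c₀ * qs₁ * Ssum * (Cκ * ℓ ^ κ) :=
        add_le_add (mul_le_mul_of_nonneg_left h2 hA) (mul_le_mul_of_nonneg_left h3 hA)
    _ = 2 * |c| * c₀ * qs₁ * Ssum * (Cκ * ℓ ^ κ) := by ring

end Error

end Literature.MathematicalPhysics.QuantumFieldTheory.Balaban1983to89.B2Eq225PsiOne
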